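/-
Copyright (c) 2026. All rights reserved.
Released under Apache 2.0 license as described in the file LICENSE.
Authors: abc-iut cell, prover seat abc-iut-L4-d2 (gen 6).
-/
import Literature.AnabelianGeometry.AbsoluteAnabelian.GaloisTheatersNumberFieldShadowPanalocal
import Literature.AnabelianGeometry.AbsoluteAnabelian.GlobalKummerMaps
import Literature.AnabelianGeometry.EtaleTheta.KummerFieldUnits
import HarnessLib

/-!
# [AbsTopIII] Def 5.1 (v) at the number-field shadow context: the `TM`-pair vocabulary with GENUINE global data `ℚ̄ˣ`

S. Mochizuki, *Topics in absolute anabelian geometry III* [MochizukiAbsTopIII2015], Def 5.1 (v) pp. 116–117 (global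
`T`-pairs: "`M_{T⊚}(Π)` … the object of `T⊚` determined by … `k^×_NF(Π)` [if `T⊚ = TLG`] … equipped with a continuous
action by `Π`"; `M_T(Π, v)`, `ρ_v(Π)`), Cor 5.2 (iii) p. 119.  The cell typed the `T`-pair language as the INTERFACE
`TPairVocabulary R T` (`TPairs.lean`, abc-iut-L4-t3) and the underlying-group data of Cor 5.2 (iii) as `GlobCarrier`
(`GlobalKummerMaps.lean`); so far only DEGENERATE vocabularies existed (`TPairsTrivialContext.lean`,
`GlobalKummerMapsCarrierNonVacuity.lean`).

THIS DEF-BEARING FILE builds, over the number-field shadow context `NumberFieldShadow.context F` (abc-iut-L4-d2 g6), the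
`TM`-pair vocabulary with GENUINE GLOBAL ARITHMETIC DATA and honest stubs elsewhere (census
HOME/staging/L4/abc-iut-L4-d2/gen4/COR52III-CONTEXT-CENSUS.md §3–§4):

* `T = TM`, `T⊚ = TLG` modelled by Mathlib's `CommGrpCat` (discrete abelian groups; `(−)^{T⊚} := 𝟭`);
* `M_{TLG}(Π_E) := ℚ̄ˣ` (`k^×_NF`, GENUINE) with `Π_E` acting through its `ℚ`-chart by the Galois action
  (`unitsAutHom`, `shadowGlobAct`); `M_TM(Π_E, v) := ℚ̄ˣ` with the decomposition group acting likewise, `ρ_v := 𝟙`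
  (honest simplification: print's `M_v` is the `v`-adic datum `𝒪^▷`; here the global datum restricted to `Π_v`);
* continuity predicates = "stabilisers are open"; `IsMLFGaloisPair (D ↷ M) :=` "`D` is of MLF-Galois type" (the
  group-theoretic half of Def 3.1 (ii) only — HONEST PARTIAL); Kummer structures, cyclotomes, `ZIndex`: STUBS (`PUnit`,
  trivial profinite group, `PEmpty`) exactly as in the degenerate vocabulary — no archimedean / cyclotomic content;
* `shadowVocabulary F : TPairVocabulary (context F) .TM`;
* `shadowCarrier F : (shadowVocabulary F).GlobCarrier` — underlying groups = the objects themselves; `|M⊚|` of ANY global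
  `TM`-pair is rootable (transported from `ℚ̄ˣ` along the reference isomorphism `ψ⊚`, `rootableByOfMulEquiv`) and has
  open stabilisers (transported likewise, `ψ⊚` being `Π`-equivariant);
* `shadowGlobalTPair F : GlobalTPair (shadowVocabulary F)` — the CANONICAL global `TM`-pair `M⊚_TM(E_F)` (Cor 5.2 (iv)
  object map at `E_F`; `isContGlob_shadowGlobAct`, `isMLFGaloisPair_shadowLocAct`): global `TM`-pairs over the shadow EXIST.

The point (proof-only sequel `GaloisTheatersNumberFieldShadowTPairsCor52iii.lean`): Cor 5.2 (iii)'s `↪`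
(`Cor52iiiKummerInjective`, F-3956) HOLDS for this vocabulary/carrier — the global Kummer map of EVERY global `TM`-pair
over the shadow is injective — by abc-iut-L4-d2 g4's `units_eq_one_of_fixed_of_forall_exists_fixed_pow` at `F = ℚ`.
HONEST LABEL: shadow (`Δ = 1`), genuine global Galois data, stub local/archimedean/cyclotomic structure; NOT print's
`T`-pairs of an elliptically admissible curve (E-L4-13).  No `instance`/`notation`/attribute changes; nothing here bears on
[IUTchIII] Cor. 3.12 or takes a side; typed ≠ proved.
-/

noncomputable section

open scoped Pointwise Topology
open CategoryTheory NumberField Field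

namespace Literature.AnabelianGeometry.AbsoluteAnabelian

namespace NumberFieldShadow

universe v

/-! ### Group automorphisms as automorphisms in `CommGrpCat` -/

/-- A group automorphism of `M` as an automorphism of the object `M` of `CommGrpCat` (`T⊚ = TLG` modelled by discrete
abelian groups), multiplicatively: `MulAut M →* Aut M`. [cite: MochizukiAbsTopIII2015, Def 5.1 (v) p.117] -/
def mulAutToAut (M : Type) [CommGroup M] : MulAut M →* Aut (CommGrpCat.of M) where
  toFun e := e.toCommGrpIso
  map_one' := by
    ext x
    rfl
  map_mul' e f := by
    ext x
    rfl

/-- Unfolding: the automorphism acts by `e`. [cite: MochizukiAbsTopIII2015, Def 5.1 (v) p.117] -/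
theorem mulAutToAut_hom_apply (M : Type) [CommGroup M] (e : MulAut M) (x : M) :
    (mulAutToAut M e).hom.hom x = e x := rfl

/-- **`G_ℚ ↷ ℚ̄ˣ` in `CommGrpCat`**: the genuine Galois action on `k^×_NF = ℚ̄ˣ` as a homomorphism `G_ℚ →* Aut(ℚ̄ˣ)`.
[cite: MochizukiAbsTopIII2015, Def 5.1 (v) p.117] -/
def unitsAutHom : absoluteGaloisGroup ℚ →* Aut (CommGrpCat.of (AlgebraicClosure ℚ)ˣ) :=
  (mulAutToAut (AlgebraicClosure ℚ)ˣ).comp (MulDistribMulAction.toMulAut (absoluteGaloisGroup ℚ) (AlgebraicClosure ℚ)ˣ)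

/-- Unfolding: `unitsAutHom σ` acts by `σ • −`. [cite: MochizukiAbsTopIII2015, Def 5.1 (v) p.117] -/
theorem unitsAutHom_hom_apply (σ : absoluteGaloisGroup ℚ) (x : (AlgebraicClosure ℚ)ˣ) :
    (unitsAutHom σ).hom.hom x = σ • x := rfl

/-- `M_{TLG}(Π_E) = ℚ̄ˣ` with `Π_E` acting through its `ℚ`-chart. [cite: MochizukiAbsTopIII2015, Def 5.1 (v) p.117] -/
def shadowGlobAct (E : FundamentalExtension.{0}) : E.arith →* Aut (CommGrpCat.of (AlgebraicClosure ℚ)ˣ) :=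
  unitsAutHom.comp (ratChart E).toMonoidHom

/-- Unfolding: `g ∈ Π_E` acts on `ℚ̄ˣ` by `ratChart E g • −`. [cite: MochizukiAbsTopIII2015, Def 5.1 (v) p.117] -/
theorem shadowGlobAct_hom_apply (E : FundamentalExtension.{0}) (g : E.arith) (x : (AlgebraicClosure ℚ)ˣ) :
    (shadowGlobAct E g).hom.hom x = ratChart E g • x := rfl

/-- `Π_v ↷ M_TM(Π_E, v) := ℚ̄ˣ` (the decomposition group acting through the chart).
[cite: MochizukiAbsTopIII2015, Def 5.1 (v) p.117] -/
def shadowLocAct (E : FundamentalExtension.{0}) (v : (contextProVal E).carrier) :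
    (contextProVal E).decompGrp v →* Aut (CommGrpCat.of (AlgebraicClosure ℚ)ˣ) :=
  (shadowGlobAct E).comp ((contextProVal E).decomp v).subtype

variable (F : Type) [Field F] [NumberField F]

/-! ### The vocabulary -/

/-- **The `TM`-pair vocabulary of the number-field shadow** over `NumberFieldShadow.context F`: `T = T⊚ :=` discrete
abelian groups (`CommGrpCat`), `M_{TLG}(Π) := ℚ̄ˣ` with the GENUINE Galois action through the `ℚ`-chart, local data
`:= ℚ̄ˣ` with the decomposition-group action and `ρ_v := 𝟙`, continuity = open stabilisers, `IsMLFGaloisPair :=`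
"the group is of MLF-Galois type" (partial), Kummer structures / cyclotomes / `ZIndex` = STUBS.
[cite: MochizukiAbsTopIII2015, Def 5.1 (v) p.117] -/
def shadowVocabulary : TPairVocabulary (context F) .TM where
  LocObj := CommGrpCat.{0}
  GlobObj := CommGrpCat.{0}
  toGlob := 𝟭 CommGrpCat.{0}
  IsContLoc := fun {D} {M} act => ∀ m : M, ∃ U : OpenSubgroup D, ∀ u : D, u ∈ U → (act u).hom.hom m = m
  IsContGlob := fun {P} {M} act => ∀ m : M, ∃ U : OpenSubgroup P, ∀ u : P, u ∈ U → (act u).hom.hom m = m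
  IsMLFGaloisPair := fun {D} {_} _ => IsMLFGaloisType D
  KummerStr := fun _ _ => PUnit.{1}
  IsAutHolPair := fun _ => True
  kummerTransport := fun _ _ k => k
  kummerTransport_refl := fun _ => rfl
  globData := fun _ => CommGrpCat.of (AlgebraicClosure ℚ)ˣ
  globAct := shadowGlobAct
  locDataNon := fun _ _ => CommGrpCat.of (AlgebraicClosure ℚ)ˣ
  locDataArc := fun _ _ => CommGrpCat.of (AlgebraicClosure ℚ)ˣ
  locAct := fun E v => shadowLocAct E v.1
  locKummer := fun _ _ => PUnit.unit
  locRestrictNon := fun _ _ => 𝟙 _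
  locRestrictArc := fun _ _ => 𝟙 _
  cyclotome := fun _ => ProfiniteGrp.of PUnit.{1}
  cyclotomeGrp := fun _ => ProfiniteGrp.of PUnit.{1}
  IsCyclotomeCompatible := fun _ _ => True
  IsCyclotomeArchCompatible := fun _ _ => True
  ZIndex := PEmpty.{1}
  IsGeomIsoTo := fun z _ => z.elim

/-- The global datum of the shadow vocabulary is `ℚ̄ˣ`. [cite: MochizukiAbsTopIII2015, Def 5.1 (v) p.117] -/
theorem shadowVocabulary_globData (E : FundamentalExtension.{0}) :
    (shadowVocabulary F).globData E = CommGrpCat.of (AlgebraicClosure ℚ)ˣ := rfl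

/-- Its action is the chart action. [cite: MochizukiAbsTopIII2015, Def 5.1 (v) p.117] -/
theorem shadowVocabulary_globAct (E : FundamentalExtension.{0}) :
    (shadowVocabulary F).globAct E = shadowGlobAct E := rfl

/-! ### The underlying-group data (`GlobCarrier`) -/

/-- Rootability transported along a group isomorphism. [cite: MochizukiAbsTopIII2015, Def 5.1 (v) p.117] -/
@[reducible] def rootableByOfMulEquiv {A B : Type} [CommGroup A] [CommGroup B] (e : A ≃* B) [RootableBy A ℕ] :
    RootableBy B ℕ where
  root b n := e (RootableBy.root (e.symm b) n)
  root_zero b := by rw [RootableBy.root_zero, map_one]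
  root_cancel {n} b hn := by
    rw [← map_pow, RootableBy.root_cancel _ hn, MulEquiv.apply_symm_apply]

/-- The global datum `M⊚` of ANY global `TM`-pair over the shadow is isomorphic (as a group) to `ℚ̄ˣ`, through a
reference isomorphism `ψ⊚`. [cite: MochizukiAbsTopIII2015, Def 5.1 (v) p.117] -/
theorem nonempty_mulEquiv_of_globalTPair (P : GlobalTPair (shadowVocabulary F)) :
    Nonempty ((AlgebraicClosure ℚ)ˣ ≃* (show CommGrpCat.{0} from P.M)) := by
  obtain ⟨-, -, -, -, ψ, -, -, -⟩ := P.exists_reference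
  exact ⟨ψ.commGroupIsoToMulEquiv⟩

/-- A reference isomorphism `ψ⊚ : ℚ̄ˣ ≅ M⊚` that is `Π`-EQUIVARIANT (condition (a) of Def 5.1 (v)) exists for every global
`TM`-pair over the shadow. [cite: MochizukiAbsTopIII2015, Def 5.1 (v) p.117] -/
theorem exists_equivariant_iso_of_globalTPair (P : GlobalTPair (shadowVocabulary F)) :
    ∃ ψ : (CommGrpCat.of (AlgebraicClosure ℚ)ˣ : CommGrpCat.{0}) ≅ P.M, ∀ (g : P.theater.grp) (x : (AlgebraicClosure ℚ)ˣ),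
      ψ.hom.hom (ratChart P.theater.ext g • x) = (P.act g).hom.hom (ψ.hom.hom x) := by
  obtain ⟨-, -, -, -, ψ, -, -, ha, -⟩ := P.exists_reference
  refine ⟨ψ, fun g x => ?_⟩
  have h := ha g
  have h' := congrArg (fun φ : ((shadowVocabulary F).globData P.theater.ext ⟶ P.M) => φ.hom x) h
  exact h'

/-- **The underlying-group data over the shadow vocabulary**: `|M| := M` itself (objects of `T⊚` ARE discrete abelian
groups); rootability and open stabilisers of `|M⊚|` for every global `TM`-pair, transported from `ℚ̄ˣ` along an
equivariant reference isomorphism. [cite: MochizukiAbsTopIII2015, Def 5.1 (v) p.117] -/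
def shadowCarrier : (shadowVocabulary F).GlobCarrier where
  carrier M := M
  map f := f.hom
  map_id _ := rfl
  map_comp _ _ := rfl
  rootable P := rootableByOfMulEquiv (Classical.choice (nonempty_mulEquiv_of_globalTPair F P))
  exists_open_stabilizer P m := by
    obtain ⟨ψ, hψ⟩ := exists_equivariant_iso_of_globalTPair F P
    -- `m = ψ x`
    let x : (AlgebraicClosure ℚ)ˣ := ψ.inv.hom m
    have hx : ψ.hom.hom x = m := by
      change (ψ.inv ≫ ψ.hom).hom m = m
      rw [ψ.inv_hom_id]
      rfl
    -- the stabiliser of `x` in `G_ℚ` is open; pull it back along the chart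
    have hopen : IsOpen {σ : absoluteGaloisGroup ℚ | σ • (x : AlgebraicClosure ℚ) = x} :=
      NumberFieldValuationProSet.isOpen_preimage_smul_singleton ℚ (x : AlgebraicClosure ℚ) x
    let U : OpenSubgroup P.theater.grp :=
      ⟨(MulAction.stabilizer (absoluteGaloisGroup ℚ) (x : AlgebraicClosure ℚ)).comap (ratChart P.theater.ext).toMonoidHom,
        hopen.preimage (ratChart P.theater.ext).continuous⟩
    refine ⟨U, fun u hu => ?_⟩
    have hu' : ratChart P.theater.ext u • (x : AlgebraicClosure ℚ) = x := hu
    have hux : ratChart P.theater.ext u • x = x := Units.ext (by rw [Units.coe_smul]; exact hu')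
    change (P.act u).hom.hom m = m
    rw [← hx, ← hψ u x, hux]

/-! ### Non-vacuity: the canonical global `TM`-pair over the shadow -/

/-- The chart action `Π_E ↷ ℚ̄ˣ` has open stabilisers (continuity for the discrete topology).
[cite: MochizukiAbsTopIII2015, Def 5.1 (v) p.117] -/
theorem isContGlob_shadowGlobAct (E : FundamentalExtension.{0}) :
    (shadowVocabulary F).IsContGlob ((shadowVocabulary F).globAct E) := by
  show ∀ x : (AlgebraicClosure ℚ)ˣ, ∃ U : OpenSubgroup E.arith, ∀ u : E.arith, u ∈ U → ratChart E u • x = x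
  intro x
  have hopen : IsOpen {σ : absoluteGaloisGroup ℚ | σ • (x : AlgebraicClosure ℚ) = x} :=
    NumberFieldValuationProSet.isOpen_preimage_smul_singleton ℚ _ _
  refine ⟨⟨(MulAction.stabilizer (absoluteGaloisGroup ℚ) (x : AlgebraicClosure ℚ)).comap (ratChart E).toMonoidHom,
      hopen.preimage (ratChart E).continuous⟩, fun u hu => ?_⟩
  have hu' : ratChart E u • (x : AlgebraicClosure ℚ) = x := hu
  exact Units.ext (by rw [Units.coe_smul]; exact hu')

/-- The local pairs `(Π_v ↷ ℚ̄ˣ)` of the shadow satisfy the vocabulary's MLF-Galois-pair predicate (`Π_v` is of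
MLF-Galois type, `isMLFGaloisType_decomp_context`) at admissible `Π_E`. [cite: MochizukiAbsTopIII2015, Def 5.1 (v) p.117] -/
theorem isMLFGaloisPair_shadowLocAct {E : FundamentalExtension.{0}} (hE : IsAdmissible F E)
    (v : ((context F).proVal E).non) :
    (shadowVocabulary F).IsMLFGaloisPair ((shadowVocabulary F).locAct E v) :=
  isMLFGaloisType_decomp_context F hE v.1 v.2 _

/-- **The canonical global `TM`-pair `M⊚_TM(E_F)` over the shadow vocabulary** (Cor 5.2 (iv), object map at `E_F`): global
`TM`-pairs over the shadow EXIST. [cite: MochizukiAbsTopIII2015, Cor 5.2 (iv) p.120] -/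
def shadowGlobalTPair : GlobalTPair (shadowVocabulary F) :=
  (shadowVocabulary F).canonical (extension F) (isAdmissible_extension F) (isContGlob_shadowGlobAct F _)
    (fun v => isMLFGaloisPair_shadowLocAct F (isAdmissible_extension F) v) (fun _ => trivial)

/-- Global `TM`-pairs over the shadow vocabulary exist. [cite: MochizukiAbsTopIII2015, Cor 5.2 (iv) p.120] -/
theorem nonempty_globalTPair_shadow : Nonempty (GlobalTPair (shadowVocabulary F)) :=
  ⟨shadowGlobalTPair F⟩

end NumberFieldShadow

end Literature.AnabelianGeometry.AbsoluteAnabelian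

end
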